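import Literature.AlgebraicGeometry.Modules.TensorSectionsLocalization
import Literature.AlgebraicGeometry.Modules.TensorQuasicoherent
import Literature.AlgebraicGeometry.Morphisms.DevissageClass
import Mathlib.RingTheory.TensorProduct.Finite
import HarnessLib

/-!
# Sections of `M ⊗ N` over an affine open: `Γ(V, M ⊗ N) = Γ(V, M) ⊗_{Γ(V,𝒪)} Γ(V, N)`
# (Hartshorne II Prop. 5.2 (b); The Stacks Project, Tag 01I8 (1))

Layer `Literature/AlgebraicGeometry/Modules` (one definition — the packaged linear equivalence —, 0 named facts, no
instances, no notation). For AFFINE-LOCALIZING (= quasi-coherent) `𝒪_X`-modules `M`, `N` and an AFFINE open `V` of a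
scheme `X`, the sheafification unit of the tree's tensor product (`Modules/TensorProduct.tensorObj`, Stacks 01CA)

  `η_V : M(V) ⊗_{𝒪_X(V)} N(V) → Γ(V, M ⊗ N)`, `m ⊗ n ↦ m ⊗ n|` (`Modules/TensorProductLocallyFree.tensorUnitHom`,
  elementary tensors `Modules/PullbackTensor.tmulSection`)

is BIJECTIVE (`tensorUnitHom_app_bijective_of_isAffineOpen`): Hartshorne, *Algebraic Geometry* II Prop. 5.2 (b) "`(M ⊗_A N)~ ≅ M~ ⊗ N~`",
The Stacks Project, Tag 01I8 (1) "`M~ ⊗_{𝒪_X} N~ = (M ⊗_R N)~`", i.e. `Γ(Spec A, M~ ⊗ N~) = M ⊗_A N`; the tree had this only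
below a common frame neighbourhood of two finite locally free modules
(`Modules/TensorProductLocallyFree.tensorUnitHom_app_bijective`). Proof (Stacks 00EK, as in the tree's
`Modules/CechLocalizedSectionsAffine`): a presheaf tensor killed by `η` vanishes locally (Stacks 007X), hence on a
finite standard cover `(D(g_a))` of `V`, hence is zero by the separation half of 00EK for the localizing system of
`Modules/TensorSectionsLocalization` (`M(D(g)) ⊗ N(D(g)) = (M(V) ⊗ N(V))_g`); a section of `M ⊗ N` over `V` lifts
locally, hence on a finite standard cover, the lifts agree on the `D(g_a g_b)` by the injectivity just proved, and
glue by the gluing half of 00EK.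

* `tensorUnitHom_app_injective_of_isAffineOpen`, `tensorUnitHom_app_surjective_of_isAffineOpen`,
  **`tensorUnitHom_app_bijective_of_isAffineOpen`**;
* **`tensorSectionsEquiv hM hN hV : TSec M N V ≃ₗ[𝒪_X(V)] Γ(V, M ⊗ N)`** (`LinearEquiv.ofBijective`), `tensorSectionsEquiv_apply`,
  `tensorSectionsEquiv_tmul` (`m ⊗ n ↦ tmulSection m n`), `tensorSectionsEquiv_symm_tmulSection`;
* `exists_tsec_eq_of_isAffineOpen` — every section of `M ⊗ N` over an affine open is the image of a presheaf tensor
  `∑ mᵢ ⊗ nᵢ`;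
* `IsAffineFiniteType.tensorObj`, **`Morphisms.Coh.tensorObj`** — `M ⊗ N` is of affine-finite type ∕ COHERENT (the tree's
  affine-local `Coh` = affine-localizing + finitely generated sections on affines) when `M`, `N` are (Stacks 01CE (3)–(4):
  "if `𝓕`, `𝓖` are of finite type [coherent], so is `𝓕 ⊗ 𝓖`"; Hartshorne II Cor. 5.7 context), with no hypothesis on `X`.

Everything is proved; no named fact. Library only (cell `pub-hodge-ring2`, count-neutral; proves nothing about any crux,
route or conjecture).

## References

* R. Hartshorne, *Algebraic Geometry*, GTM 52 (1977), II Prop. 5.1, II Prop. 5.2 (b) (p. 110). [Hartshorne1977]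
* The Stacks Project, Tag 01I8 (1), Tag 00EK, Tag 007X, Tag 01CA. [StacksProject]
* U. Görtz, T. Wedhorn, *Algebraic Geometry I*, 2nd ed. (2020), Prop. 7.14 (2), Cor. 7.19. [GortzWedhorn2020]
-/

noncomputable section

-- `TopCat.Presheaf`/`Scheme.Modules` are not reducible (as in Mathlib's `AlgebraicGeometry/Modules/Sheaf.lean`).
set_option backward.isDefEq.respectTransparency false

open CategoryTheory AlgebraicGeometry Opposite TopologicalSpace MonoidalCategory
open Literature.Algebra.Homology
open scoped TensorProduct

universe u

namespace Literature.AlgebraicGeometry.Modules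

variable {X : Scheme.{u}} (M N : X.Modules) {V : X.Opens}

/-! ### §1 The unit on sections and restriction -/

/-- The restriction maps of the presheaf tensor product are `resT` (`resP` of `Modules/TensorAssociator`; `rfl`).
[cite: StacksProject, Tag 01CA] -/
theorem resP_tensorPresheaf {W : X.Opens} (h : W ≤ V) (x : TSec M N V) :
    resP (X := X) (tensorPresheaf M N) h x = resT M N h x := rfl

/-- The sheafification unit of the presheaf tensor product is `tensorUnitHom` (`rfl`). [cite: StacksProject, Tag 01CA] -/
theorem sheafifyUnit_tensorPresheaf : sheafifyUnit (X := X) (tensorPresheaf M N) = tensorUnitHom M N := rfl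

variable {M N} (hM : IsAffineLocalizing M) (hN : IsAffineLocalizing N) (hV : IsAffineOpen V)
include hM hN hV

/-! ### §2 Injectivity -/

/-- **The unit `η_V : M(V) ⊗_{𝒪(V)} N(V) → Γ(V, M ⊗ N)` is INJECTIVE** for `V` affine and `M`, `N` affine-localizing: a
presheaf tensor killed by `η` vanishes locally (Stacks 007X), hence on a finite standard cover of `V`, hence is zero by
the separation half of Stacks 00EK (`tsec_eq_zero_of_forall_resT`). [cite: Hartshorne1977, II Prop. 5.2 (b) (p. 110)]
[cite: StacksProject, Tag 01I8] [cite: StacksProject, Tag 00EK] -/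
theorem tensorUnitHom_app_injective_of_isAffineOpen : Function.Injective ((tensorUnitHom M N).app (op V)) := by
  intro x y hxy
  rw [← sub_eq_zero] at hxy ⊢
  rw [← map_sub] at hxy
  generalize x - y = z at hxy ⊢
  -- local vanishing of `z`
  have hloc := fun (p : X) (hp : p ∈ V) => exists_resP_eq_zero_nhds (X := X) (tensorPresheaf M N) V z hxy p hp
  choose W hWV hpW hzW using hloc
  have hbo : ∀ p : V, ∃ f : Γ(X, V), X.basicOpen f ≤ W p p.2 ∧ (p : X) ∈ X.basicOpen f :=
    fun p => hV.exists_basicOpen_le ⟨p, hpW p p.2⟩ p.2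
  choose gp hgpW hpgp using hbo
  obtain ⟨T, hT, hspan⟩ := PCech.exists_finset_span_eq_top hV gp hpgp
  -- `z|_{D(t)} = 0` for `t ∈ T`
  have hzT : ∀ t : (↑T : Set Γ(X, V)), resT M N (X.basicOpen_le (t : Γ(X, V))) z = 0 := by
    rintro ⟨t, ht⟩
    obtain ⟨p, rfl⟩ := hT ht
    have h0 : resT M N (hWV p p.2) z = 0 := hzW p p.2
    rw [← resT_resT M N (hWV p p.2) (hgpW p), h0, resT_zero]
  haveI : Finite (↑T : Set Γ(X, V)) := T.finite_toSet.to_subtype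
  exact tsec_eq_zero_of_forall_resT (g := fun t : (↑T : Set Γ(X, V)) => (t : Γ(X, V))) hM hN hV
    (by rwa [Subtype.range_coe_subtype, Set.setOf_mem_eq]) z hzT

/-! ### §3 Surjectivity -/

/-- **The unit `η_V` is SURJECTIVE** for `V` affine and `M`, `N` affine-localizing: a section of `M ⊗ N` over `V` lifts
locally (Stacks 007X), hence on a finite standard cover `(D(t))_{t ∈ T}` of `V`; the lifts agree on the `D(t t')` by
injectivity there, so glue by the gluing half of Stacks 00EK (`exists_tsec_of_compatible`) to a presheaf tensor over `V`,
whose image agrees with the given section on the cover. [cite: Hartshorne1977, II Prop. 5.2 (b) (p. 110)]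
[cite: StacksProject, Tag 01I8] [cite: StacksProject, Tag 00EK] -/
theorem tensorUnitHom_app_surjective_of_isAffineOpen : Function.Surjective ((tensorUnitHom M N).app (op V)) := by
  intro t
  -- local lifts
  have hloc := fun (p : X) (hp : p ∈ V) =>
    exists_sheafifyUnit_app_eq_nhds (X := X) (tensorPresheaf M N) V t p hp
  choose W hWV hpW a ha using hloc
  have hbo : ∀ p : V, ∃ f : Γ(X, V), X.basicOpen f ≤ W p p.2 ∧ (p : X) ∈ X.basicOpen f :=
    fun p => hV.exists_basicOpen_le ⟨p, hpW p p.2⟩ p.2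
  choose gp hgpW hpgp using hbo
  obtain ⟨T, hT, hspan⟩ := PCech.exists_finset_span_eq_top hV gp hpgp
  haveI : Finite (↑T : Set Γ(X, V)) := T.finite_toSet.to_subtype
  -- for `τ ∈ T` a point `p τ` with `gp (p τ) = τ`, and the lift `b τ` over `D(τ) ⊆ W (p τ)`
  have hTp : ∀ τ : (↑T : Set Γ(X, V)), ∃ p : V, gp p = τ := fun τ => hT τ.2
  choose pτ hpτ using hTp
  have hDW : ∀ τ : (↑T : Set Γ(X, V)), X.basicOpen (τ : Γ(X, V)) ≤ W (pτ τ) (pτ τ).2 := fun τ => by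
    rw [← hpτ τ]; exact hgpW (pτ τ)
  let b : ∀ τ : (↑T : Set Γ(X, V)), TSec M N (X.basicOpen (τ : Γ(X, V))) :=
    fun τ => resT M N (hDW τ) (a (pτ τ) (pτ τ).2)
  -- `η (b τ) = t|_{D(τ)}`
  have hb : ∀ τ : (↑T : Set Γ(X, V)),
      (sheafifyUnit (X := X) (tensorPresheaf M N)).app (op (X.basicOpen (τ : Γ(X, V)))) (b τ) =
      resP (X := X) (toCommRingedPresheaf ((modulesSheafify X).obj (tensorPresheaf M N)))
        (X.basicOpen_le (τ : Γ(X, V))) t := by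
    intro τ
    have h1 := app_resP (X := X) (sheafifyUnit (X := X) (tensorPresheaf M N)) (hDW τ) (a (pτ τ) (pτ τ).2)
    rw [ha, resP_resP] at h1
    exact h1
  -- the lifts agree on the double overlaps (injectivity on `D(τ τ')`)
  have hcompat : ∀ τ τ' : (↑T : Set Γ(X, V)),
      resT M N (W := X.basicOpen ((τ : Γ(X, V)) * (τ' : Γ(X, V))))
          (by rw [Scheme.basicOpen_mul]; exact inf_le_left) (b τ) =
        resT M N (W := X.basicOpen ((τ : Γ(X, V)) * (τ' : Γ(X, V))))
          (by rw [Scheme.basicOpen_mul]; exact inf_le_right) (b τ') := by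
    intro τ τ'
    have h₁ : X.basicOpen ((τ : Γ(X, V)) * (τ' : Γ(X, V))) ≤ X.basicOpen (τ : Γ(X, V)) := by
      rw [Scheme.basicOpen_mul]; exact inf_le_left
    have h₂ : X.basicOpen ((τ : Γ(X, V)) * (τ' : Γ(X, V))) ≤ X.basicOpen (τ' : Γ(X, V)) := by
      rw [Scheme.basicOpen_mul]; exact inf_le_right
    apply tensorUnitHom_app_injective_of_isAffineOpen hM hN (hV.basicOpen _)
    have e₁ := app_resP (X := X) (sheafifyUnit (X := X) (tensorPresheaf M N)) h₁ (b τ)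
    have e₂ := app_resP (X := X) (sheafifyUnit (X := X) (tensorPresheaf M N)) h₂ (b τ')
    rw [resP_tensorPresheaf] at e₁ e₂
    refine (e₁.trans ?_).trans e₂.symm
    rw [hb, hb, resP_resP, resP_resP]
  -- glue
  obtain ⟨x, hx⟩ := exists_tsec_of_compatible (g := fun τ : (↑T : Set Γ(X, V)) => (τ : Γ(X, V))) hM hN hV
    (by rwa [Subtype.range_coe_subtype, Set.setOf_mem_eq]) b hcompat
  refine ⟨x, ?_⟩
  -- `η x = t`: both agree on the cover `(D(τ))_{τ ∈ T}` of `V`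
  have hcover : V ≤ ⨆ τ : (↑T : Set Γ(X, V)), X.basicOpen (τ : Γ(X, V)) :=
    (hV.iSup_basicOpen_eq_self_iff.mpr hspan).ge
  refine TopCat.Sheaf.eq_of_locally_eq' (Cech.abSheaf (tensorObj M N))
    (fun τ : (↑T : Set Γ(X, V)) => X.basicOpen (τ : Γ(X, V))) V (fun τ => homOfLE (X.basicOpen_le _)) hcover _ _
    fun τ => ?_
  have e := app_resP (X := X) (sheafifyUnit (X := X) (tensorPresheaf M N)) (X.basicOpen_le (τ : Γ(X, V))) x
  rw [resP_tensorPresheaf, hx] at e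
  change resP (X := X) (toCommRingedPresheaf ((modulesSheafify X).obj (tensorPresheaf M N)))
      (X.basicOpen_le (τ : Γ(X, V))) ((tensorUnitHom M N).app (op V) x) =
    resP (X := X) (toCommRingedPresheaf ((modulesSheafify X).obj (tensorPresheaf M N)))
      (X.basicOpen_le (τ : Γ(X, V))) t
  rw [← hb τ]
  exact e.symm

/-- **`η_V : M(V) ⊗_{𝒪(V)} N(V) → Γ(V, M ⊗ N)` is BIJECTIVE** for every affine open `V` and affine-localizing `M`, `N`
(Hartshorne II Prop. 5.2 (b) `(M ⊗_A N)~ ≅ M~ ⊗ N~`; Stacks 01I8 (1)). [cite: Hartshorne1977, II Prop. 5.2 (b) (p. 110)]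
[cite: StacksProject, Tag 01I8] -/
theorem tensorUnitHom_app_bijective_of_isAffineOpen : Function.Bijective ((tensorUnitHom M N).app (op V)) :=
  ⟨tensorUnitHom_app_injective_of_isAffineOpen hM hN hV, tensorUnitHom_app_surjective_of_isAffineOpen hM hN hV⟩

/-! ### §4 The packaged isomorphism `Γ(V, M) ⊗_{Γ(V,𝒪)} Γ(V, N) ≅ Γ(V, M ⊗ N)` -/

/-- **`Γ(V, M) ⊗_{Γ(V,𝒪_X)} Γ(V, N) ≃ Γ(V, M ⊗ N)`** for `V` affine and `M`, `N` affine-localizing (quasi-coherent): the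
sheafification unit as an `𝒪_X(V)`-linear equivalence (Hartshorne II Prop. 5.2 (b); Stacks 01I8 (1)).
[cite: Hartshorne1977, II Prop. 5.2 (b) (p. 110)] [cite: StacksProject, Tag 01I8] -/
def tensorSectionsEquiv : TSec M N V ≃ₗ[secRing X V] secMod (tensorObj M N) V :=
  LinearEquiv.ofBijective ((tensorUnitHom M N).app (op V)).hom (tensorUnitHom_app_bijective_of_isAffineOpen hM hN hV)

/-- `tensorSectionsEquiv` is the unit `η_V`. [cite: StacksProject, Tag 01I8] -/
theorem tensorSectionsEquiv_apply (x : TSec M N V) :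
    tensorSectionsEquiv hM hN hV x = (tensorUnitHom M N).app (op V) x := rfl

/-- On pure tensors `tensorSectionsEquiv (m ⊗ n) = tmulSection m n`. [cite: StacksProject, Tag 01I8] [cite: StacksProject, Tag 01CA] -/
theorem tensorSectionsEquiv_tmul (m : secMod M V) (n : secMod N V) :
    tensorSectionsEquiv hM hN hV (m ⊗ₜ n) = tmulSection M N V m n := rfl

/-- The inverse sends an elementary tensor section back to the pure tensor: `e⁻¹ (m ⊗ n|) = m ⊗ n`.
[cite: StacksProject, Tag 01I8] -/
theorem tensorSectionsEquiv_symm_tmulSection (m : secMod M V) (n : secMod N V) :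
    (tensorSectionsEquiv hM hN hV).symm (tmulSection M N V m n) = m ⊗ₜ n :=
  (tensorSectionsEquiv hM hN hV).injective (by rw [LinearEquiv.apply_symm_apply]; rfl)

/-- **Every section of `M ⊗ N` over an affine open is a finite sum of elementary tensors of sections over that open**:
it is `η_V` of a presheaf tensor. [cite: Hartshorne1977, II Prop. 5.2 (b) (p. 110)] [cite: StacksProject, Tag 01I8] -/
theorem exists_tsec_eq_of_isAffineOpen (s : secMod (tensorObj M N) V) :
    ∃ x : TSec M N V, (tensorUnitHom M N).app (op V) x = s :=
  tensorUnitHom_app_surjective_of_isAffineOpen hM hN hV s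

/-! ### §5 Finite type and coherence of `M ⊗ N` -/

omit hV in
/-- **`M ⊗ N` is of affine-finite type** for `M`, `N` affine-localizing of affine-finite type: on an affine `V`,
`Γ(V, M ⊗ N) ≅ Γ(V, M) ⊗ Γ(V, N)` is finitely generated (Mathlib `Module.Finite.tensorProduct`).
[cite: StacksProject, Tag 01CE] [cite: Hartshorne1977, II Prop. 5.2 (b) (p. 110)] -/
theorem IsAffineFiniteType.tensorObj (hMf : IsAffineFiniteType M) (hNf : IsAffineFiniteType N) :
    IsAffineFiniteType (Modules.tensorObj M N) := by
  intro V hV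
  haveI : Module.Finite (secRing X V) (secMod M V) := hMf hV
  haveI : Module.Finite (secRing X V) (secMod N V) := hNf hV
  have h : Module.Finite (secRing X V) (secMod (Modules.tensorObj M N) V) :=
    Module.Finite.equiv (tensorSectionsEquiv hM hN hV)
  exact h

omit hM hN hV in
/-- **`M ⊗ N` is coherent for `M`, `N` coherent** in the tree's affine-local sense (`Morphisms.Coh` = affine-localizing +
affine-finite type; no hypothesis on the scheme): Stacks 01CE (4) / 01LA, Hartshorne II Cor. 5.7 context. The locally
free special case is the tree's `Coh.tensorObj_of_isFiniteLocallyFree`. [cite: StacksProject, Tag 01CE] [cite: StacksProject, Tag 01LA] -/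
theorem _root_.Literature.AlgebraicGeometry.Morphisms.Coh.tensorObj
    (hMc : Literature.AlgebraicGeometry.Morphisms.Coh M) (hNc : Literature.AlgebraicGeometry.Morphisms.Coh N) :
    Literature.AlgebraicGeometry.Morphisms.Coh (Modules.tensorObj M N) :=
  ⟨hMc.loc.tensorObj hNc.loc, IsAffineFiniteType.tensorObj hMc.loc hNc.loc hMc.ft hNc.ft⟩

end Literature.AlgebraicGeometry.Modules

end
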